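import Literature.RepresentationTheory.HarrisKudlaSweet1996.GlobalSplittingCharacters
import Literature.NumberTheory.Automorphic.QuadraticHeckeCharacterLocalComponent
import Literature.NumberTheory.Automorphic.ClassFieldCharacterLocal
import Literature.NumberTheory.Automorphic.HeckeCharacterLocalComponentSmooth
import Literature.NumberTheory.Automorphic.AdicCompletionDegreeOnePlaceEquiv
import Literature.NumberTheory.Automorphic.UnitaryGroupSplitPlace
import Literature.NumberTheory.Automorphic.QuadraticLocalBaseChange
import Literature.NumberTheory.GaloisRepresentations.HeckeCharacterCofiniteProofs
import Literature.NumberTheory.QuadraticForms.HilbertReciprocityFiniteness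
import Literature.NumberTheory.GelbartRogawski1991.UnitaryDualPairThetaKernelCM
import Mathlib.Analysis.Normed.Ring.Units
import HarnessLib

/-!
# Local components of a global splitting character `χ|_{𝕀_{L⁺}} = ε_{L/L⁺}` of a CM field
([HarrisKudlaSweet1996, §1 (1.5), (1.15)]: `χ_V|_{F^×} = ε^m_{E/F}`, read at the finite places of `F = L⁺`)

Topic `NumberTheory/GelbartRogawski1991`; namespace
`Literature.NumberTheory.GelbartRogawski1991.UnitaryDualPair.LocalSplitting`. KERNEL only: proved theorems; no
definition, no named fact, no `sorry`.

For a CM field `L` with maximal totally real subfield `L⁺`, complex conjugation `c`, a Hecke character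
`χ : 𝕀_L → ℂˣ` and a finite place `v` of `L⁺`, write `χ_w = χ.localComponent w` (`w ∣ v`) and `ι_w = toPlace v w :
L⁺_v → L_w`.  This file supplies, in tree vocabulary, the four LOCAL hypotheses on the family `χv w := χ_w⁻¹` under which
the GR-1 local skeleton of [GelbartRogawski1991, Prop. 3.1.1] constructs Kudla's splitting at `v`
(`IsTrivialNearOne`, `IsEpsilonChar`, `IsSplitPair`, the cofinite unramified clause of `eventually_isGoodPlace`):

* `eventually_localComponent_inv_unit_eq_one` — **`χ_w⁻¹ = 1` near `1`** (every `K`: `ker χ_w` is open,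
  `HeckeCharacter.isOpen_ker_localComponent`, and `K_wˣ → K_w` is open, Mathlib `Units.isOpenMap_val`);
* `eventually_forall_placesOver_localComponent_inv_eq_one` — **for all but finitely many `v`, every `χ_w`, `w ∣ v`, is
  trivial on the units** (`isUnramifiedAt_cofinite_holds`, finitely many `v` below the ramified `w`);
* `ideleBaseChange_localUnits_of_smul_eq` ∕ `_of_smul_ne` — the base change of the local idèle `⟨a⟩_v` is `⟨ι_w a⟩_w`
  at a NON-SPLIT `v` (`c • w = w`: `w` is the only place above `v`) and `⟨ι_w a⟩_w ⟨ι_w̄ a⟩_w̄` at a SPLIT `v`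
  (`w̄ = c⁻¹ • w ≠ w`) — tree `ideleBaseChange_localUnits`, `PlacesOver.eq_or_eq_galInv`;
* `isSquare_cmQuadraticGenerator_of_smul_ne` — at a split `v` the generator `θ` of `L = L⁺(√θ)` is a square in
  `L⁺_v` (`ι_w : L⁺_v ≅ L_w` is onto at a place of degree one, tree `AdicCompletionDegreeOnePlaceEquiv`), so
  `ε_v = ( · , θ)_v = 1`;
* **`localComponent_inv_toPlace_eq_hilbertSymbol`** — for `χ|_{𝕀_{L⁺}} = ε` (`IsSplittingChar L 1 χ`) and `v`
  NON-SPLIT: `χ_w⁻¹(ι_w a) = (δ², a)_v` for all `a ∈ L⁺_vˣ`, `δ = imagUnit L` (`χ_w(ι_w a) = χ(⟨a⟩_v ⊗ 1) = ε(⟨a⟩_v) =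
  (a, θ)_v`, tree `quadraticHeckeChar_localUnits`; `δ² = θ t²`, `t ∈ L⁺`) — the hypothesis `IsEpsilonChar` of the skeleton;
* **`localComponent_galInv_inv_eq`** — for `χ|_{𝕀_{L⁺}} = ε` and `v` SPLIT: `χ_{w̄}(x)⁻¹ = χ_w(c_* x)` for all
  `x ∈ L_{w̄}ˣ`, `c_* : L_{w̄} → L_w` the transport (`x = ι_{w̄} a`, `c_* ι_{w̄} = ι_w`, `χ_w(ι_w a) χ_{w̄}(ι_{w̄} a) =
  ε_v(a) = 1`) — the hypothesis `IsSplitPair` of the skeleton.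

Written for the kernel construction of [GelbartRogawski1991, Prop. 3.1.1] behind the cited input `hGRU` of the
Hodge-CM period-theorem package (stage-1 cell `pub-hodgecm`, seat GR-1; inputs of `stub_S1fin_local`).
Nothing in this file is a claim of the manuscripts adjudicated by that cell.

## References

* M. Harris, S. S. Kudla, W. J. Sweet, *Theta dichotomy for unitary groups*, J. Amer. Math. Soc. 9 (1996), §1 (1.5),
  (1.15) [HarrisKudlaSweet1996].
* J. Tate, *Global class field theory*, Ch. VII of Cassels–Fröhlich (1967), §4.3, §6 (local components)
  [CasselsFrohlichANT1967].
* O. T. O'Meara, *Introduction to Quadratic Forms* (1963), §63B, §65A [Omeara1963].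
-/

set_option autoImplicit false

noncomputable section

open NumberField IsDedekindDomain Filter
open Literature.NumberTheory.Automorphic Literature.NumberTheory.Automorphic.UnitaryGroup
open Literature.NumberTheory.GaloisRepresentations Literature.NumberTheory.QuadraticForms
open Literature.RepresentationTheory.HarrisKudlaSweet1996

namespace Literature.NumberTheory.GelbartRogawski1991.UnitaryDualPair.LocalSplitting

/-! ## §1 Any number field: `χ_w` is trivial near `1`; unramified at almost all places -/

section AnyField

variable {K : Type} [Field K] [NumberField K]

/-- **`χ_w⁻¹(x) = 1` for `x` near `1`**: the local component of a Hecke character is trivial on a neighbourhood of `1`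
(its kernel is an open subgroup of `K_wˣ`, and `K_wˣ ⊂ K_w` is open). [cite: CasselsFrohlichANT1967, Ch. VII §4.3] -/
theorem eventually_localComponent_inv_unit_eq_one (χ : HeckeCharacter K) (w : HeightOneSpectrum (𝓞 K)) :
    ∀ᶠ x in nhds (1 : w.adicCompletion K), ∀ hx : IsUnit x, (χ.localComponent w)⁻¹ hx.unit = 1 := by
  have hU : IsOpen (Units.val '' (((χ.localComponent w).ker : Subgroup (w.adicCompletion K)ˣ) :
      Set (w.adicCompletion K)ˣ)) :=
    Units.isOpenMap_val _ (χ.isOpen_ker_localComponent w)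
  filter_upwards [hU.mem_nhds ⟨1, (χ.localComponent w).ker.one_mem, Units.val_one⟩] with x hx hxu
  obtain ⟨u, hu, hux⟩ := hx
  have h : hxu.unit = u := Units.ext (by rw [IsUnit.unit_spec, hux])
  rw [h, MonoidHom.inv_apply, (MonoidHom.mem_ker).1 hu, inv_one]

end AnyField

section CM

variable (L : Type) [Field L] [NumberField L] [IsCMField L]

local notation3 "cc" => (IsCMField.complexConj L)

omit [IsCMField L] in
/-- **for all but finitely many finite places `v` of `L⁺`, `χ_w` is trivial on the units `𝒪_wˣ` for every `w ∣ v`**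
(a Hecke character is unramified outside a finite set of places of `L`, below which lie finitely many places of
`L⁺`). [cite: CasselsFrohlichANT1967, Ch. VII §4.3] -/
theorem eventually_forall_placesOver_localComponent_inv_eq_one (χ : HeckeCharacter L) :
    ∀ᶠ v : HeightOneSpectrum (𝓞 (maximalRealSubfield L)) in cofinite, ∀ (w : PlacesOver L v) (u : (w.1.adicCompletion L)ˣ),
      ValuativeRel.valuation (w.1.adicCompletion L) (u : w.1.adicCompletion L) = 1 → (χ.localComponent w.1)⁻¹ u = 1 := by
  have hfin : {w : HeightOneSpectrum (𝓞 L) | ¬ χ.IsUnramifiedAt w}.Finite :=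
    Filter.eventually_cofinite.1 (HeckeCharacter.isUnramifiedAt_cofinite_holds χ)
  refine Filter.eventually_cofinite.2 ((hfin.image fun w => w.under (𝓞 (maximalRealSubfield L))).subset ?_)
  intro v hv
  rw [Set.mem_setOf_eq] at hv
  push Not at hv
  obtain ⟨w, u, hu, hne⟩ := hv
  refine ⟨w.1, fun hunr => hne ?_, w.2⟩
  rw [MonoidHom.inv_apply, HeckeCharacter.IsUnramifiedAt.localComponent_eq_one_of_valuation_eq_one hunr hu, inv_one]

variable (v : HeightOneSpectrum (𝓞 (maximalRealSubfield L)))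

/-- at a NON-SPLIT place (`c • w = w`) `w` is the only place above `v` (`Gal(L/L⁺) = {1, c}` is transitive on the
fibre). [cite: CasselsFrohlichANT1967, Ch. VII Prop. 1.2 (ii)] -/
theorem placesOver_eq_of_smul_eq (w : PlacesOver L v) (hw : cc • w.1 = w.1) (w' : PlacesOver L v) :
    w' = w := by
  rcases PlacesOver.eq_or_eq_galInv (cc) (IsCMField.complexConj_ne_one L) w w' with h | h
  · exact h
  · rw [h]
    apply Subtype.ext
    change (cc)⁻¹ • w.1 = w.1
    conv_lhs => rw [← hw]
    rw [inv_smul_smul]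

/-- **base change of a local idèle at a non-split place**: `⟨a⟩_v ⊗ 1 = ⟨ι_w a⟩_w`.
[cite: CasselsFrohlichANT1967, Ch. VII §4.3] -/
theorem ideleBaseChange_localUnits_of_smul_eq (w : PlacesOver L v) (hw : cc • w.1 = w.1)
    (a : (v.adicCompletion (maximalRealSubfield L))ˣ) :
    AdeleRing.ideleBaseChange (maximalRealSubfield L) L (localUnits v a) =
      localUnits w.1 (Units.map (toPlace v w : v.adicCompletion (maximalRealSubfield L) →* w.1.adicCompletion L) a) := by
  classical
  have hT : ∀ w' : HeightOneSpectrum (𝓞 L), w' ∈ ({w.1} : Finset (HeightOneSpectrum (𝓞 L))) ↔ w'.under (𝓞 (maximalRealSubfield L)) = v :=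
    fun w' => ⟨fun h => by rw [Finset.mem_singleton.1 h]; exact w.2,
      fun h => Finset.mem_singleton.2 (congrArg Subtype.val (placesOver_eq_of_smul_eq L v w hw ⟨w', h⟩))⟩
  have h := ideleBaseChange_localUnits (F := maximalRealSubfield L) (E := L) v a
    (fun w' => if h : w'.under (𝓞 (maximalRealSubfield L)) = v then Units.map (toPlace v ⟨w', h⟩ : v.adicCompletion (maximalRealSubfield L) →* w'.adicCompletion L) a
      else 1)
    (fun w' h _ => by rw [dif_pos h, Units.coe_map]; rfl) {w.1} hT
  rw [h, Finset.prod_singleton, dif_pos w.2]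

/-- **base change of a local idèle at a split place**: `⟨a⟩_v ⊗ 1 = ⟨ι_w a⟩_w ⟨ι_w̄ a⟩_w̄`, `w̄ = c⁻¹ • w ≠ w`.
[cite: CasselsFrohlichANT1967, Ch. VII §4.3] -/
theorem ideleBaseChange_localUnits_of_smul_ne (w : PlacesOver L v) (hw : cc • w.1 ≠ w.1)
    (a : (v.adicCompletion (maximalRealSubfield L))ˣ) :
    AdeleRing.ideleBaseChange (maximalRealSubfield L) L (localUnits v a) =
      localUnits w.1 (Units.map (toPlace v w : v.adicCompletion (maximalRealSubfield L) →* w.1.adicCompletion L) a) *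
        localUnits (PlacesOver.galInv (cc) w).1
          (Units.map (toPlace v (PlacesOver.galInv (cc) w) :
            v.adicCompletion (maximalRealSubfield L) →* (PlacesOver.galInv (cc) w).1.adicCompletion L) a) := by
  classical
  set wb := PlacesOver.galInv (cc) w with hwb
  have hne : w.1 ≠ wb.1 := fun h => PlacesOver.galInv_ne (cc) w hw (Subtype.ext h).symm
  have hT : ∀ w' : HeightOneSpectrum (𝓞 L), w' ∈ ({w.1, wb.1} : Finset (HeightOneSpectrum (𝓞 L))) ↔ w'.under (𝓞 (maximalRealSubfield L)) = v :=
    fun w' => ⟨fun h => by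
        rcases Finset.mem_insert.1 h with h | h
        · rw [h]; exact w.2
        · rw [Finset.mem_singleton.1 h]; exact wb.2,
      fun h => by
        rcases PlacesOver.eq_or_eq_galInv (cc) (IsCMField.complexConj_ne_one L) w ⟨w', h⟩ with h' | h'
        · exact Finset.mem_insert.2 (Or.inl (congrArg Subtype.val h'))
        · exact Finset.mem_insert.2 (Or.inr (Finset.mem_singleton.2 (congrArg Subtype.val h')))⟩
  have h := ideleBaseChange_localUnits (F := maximalRealSubfield L) (E := L) v a
    (fun w' => if h : w'.under (𝓞 (maximalRealSubfield L)) = v then Units.map (toPlace v ⟨w', h⟩ : v.adicCompletion (maximalRealSubfield L) →* w'.adicCompletion L) a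
      else 1)
    (fun w' h _ => by rw [dif_pos h, Units.coe_map]; rfl) {w.1, wb.1} hT
  rw [h, Finset.prod_pair hne, dif_pos w.2, dif_pos wb.2]

/-- **at a split place `θ` is a square in `L⁺_v`**: `ι_w : L⁺_v → L_w` is onto (degree one), and `θ = α²` in `L`.
[cite: CasselsFrohlichANT1967, Ch. VII §4.3] -/
theorem isSquare_cmQuadraticGenerator_of_smul_ne (w : PlacesOver L v) (hw : cc • w.1 ≠ w.1) :
    IsSquare (algebraMap (maximalRealSubfield L) (v.adicCompletion (maximalRealSubfield L))
      ((cmQuadraticGenerator L : 𝓞 (maximalRealSubfield L)) : maximalRealSubfield L)) := by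
  obtain ⟨α, -, -, hα⟩ := cmQuadraticGenerator_spec L
  obtain ⟨he, hf⟩ := ramificationIdx_eq_one_and_inertiaDeg_eq_one_of_smul_ne (F := maximalRealSubfield L) (cc) hw
  haveI := PlacesOver.liesOver w
  obtain ⟨β, hβ⟩ := (bijective_adicCompletionOfLiesOver_of_degree_one (maximalRealSubfield L) L v w.1 he hf).2
    ((α : L) : w.1.adicCompletion L)
  refine ⟨β, (toPlace v w).injective ?_⟩
  rw [map_mul]
  change toPlace v w (((cmQuadraticGenerator L : 𝓞 (maximalRealSubfield L)) : maximalRealSubfield L) :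
      v.adicCompletion (maximalRealSubfield L)) =
    adicCompletionOfLiesOver (maximalRealSubfield L) L v w.1 β * adicCompletionOfLiesOver (maximalRealSubfield L) L v w.1 β
  rw [toPlace_coe, ← hα, hβ]
  change algebraMap L (w.1.adicCompletion L) (α ^ 2) = algebraMap L (w.1.adicCompletion L) α * algebraMap L (w.1.adicCompletion L) α
  rw [map_pow, sq]

variable {L v}

/-- `δ² = θ t²` with `t ∈ L⁺`, `t ≠ 0` (`δ = imagUnit L`, `θ = cmQuadraticGenerator L`: both `δ` and a square root `α`
of `θ` are purely imaginary, so `δ/α ∈ L⁺`). [folklore] -/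
private theorem exists_imagUnitSq_eq_mul_sq :
    ∃ t : maximalRealSubfield L, t ≠ 0 ∧ algebraMap (maximalRealSubfield L) L (imagUnitSq L) =
      algebraMap (maximalRealSubfield L) L (cmQuadraticGenerator L : maximalRealSubfield L) * algebraMap (maximalRealSubfield L) L t ^ 2 := by
  obtain ⟨α, hα0, hαc, hα⟩ := cmQuadraticGenerator_spec L
  have ht : cc (imagUnit L / α) = imagUnit L / α := by
    rw [map_div₀, complexConj_imagUnit, hαc, neg_div_neg_eq]
  refine ⟨⟨imagUnit L / α, (IsCMField.complexConj_eq_self_iff L _).1 ht⟩, fun h => ?_, ?_⟩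
  · have h' : imagUnit L / α = 0 := congrArg Subtype.val h
    exact div_ne_zero (imagUnit_ne_zero L) hα0 h'
  · rw [← hα, ← imagUnit_mul_self]
    change imagUnit L * imagUnit L = α ^ 2 * (imagUnit L / α) ^ 2
    field_simp

/-- **THE NON-SPLIT LOCAL COMPONENT OF A SPLITTING CHARACTER IS THE QUADRATIC CHARACTER** (hypothesis
`IsEpsilonChar` of the GR-1 skeleton, for `χv w := χ_w⁻¹`): if `χ|_{𝕀_{L⁺}} = ε_{L/L⁺}` and `c • w = w`, then
`χ_w⁻¹(ι_w a) = (δ², a)_v` for every `a ∈ L⁺_vˣ` (`δ = imagUnit L`).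
[cite: HarrisKudlaSweet1996, §1 (1.5), (1.15); Omeara1963, §63B, §65A] -/
theorem localComponent_inv_toPlace_eq_hilbertSymbol (χ : HeckeCharacter L) (hχ : IsSplittingChar L 1 χ)
    (w : PlacesOver L v) (hw : cc • w.1 = w.1) (a : (v.adicCompletion (maximalRealSubfield L))ˣ) :
    ((((χ.localComponent w.1)⁻¹ : (w.1.adicCompletion L)ˣ →* ℂˣ)
        (Units.map (toPlace v w : v.adicCompletion (maximalRealSubfield L) →* w.1.adicCompletion L) a) : ℂˣ) : ℂ) =
      hilbertSymbol (v.adicCompletion (maximalRealSubfield L)) (((imagUnitSq L : maximalRealSubfield L) : maximalRealSubfield L) : v.adicCompletion (maximalRealSubfield L)) (a : v.adicCompletion (maximalRealSubfield L)) := by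
  have key := hχ (localUnits v a)
  rw [pow_one, ideleBaseChange_localUnits_of_smul_eq L v w hw a, quadraticHeckeCharCM_def] at key
  -- `χ_w(ι_w a) = (a, θ)_v`
  have hval : (((χ.localComponent w.1) (Units.map (toPlace v w : v.adicCompletion (maximalRealSubfield L) →* w.1.adicCompletion L) a) : ℂˣ) : ℂ) =
      (hilbertSymbol (v.adicCompletion (maximalRealSubfield L)) (a : v.adicCompletion (maximalRealSubfield L))
        (algebraMap (maximalRealSubfield L) (v.adicCompletion (maximalRealSubfield L)) ((cmQuadraticGenerator L : maximalRealSubfield L) : maximalRealSubfield L)) : ℂ) := by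
    rw [HeckeCharacter.localComponent_apply, key]
    exact quadraticHeckeChar_localUnits (not_isSquare_cmQuadraticGenerator L) v a
  -- `δ² = θ t²`
  obtain ⟨t, ht0, ht⟩ := exists_imagUnitSq_eq_mul_sq (L := L)
  have ht' : (((imagUnitSq L : maximalRealSubfield L) : maximalRealSubfield L) : v.adicCompletion (maximalRealSubfield L)) =
      algebraMap (maximalRealSubfield L) (v.adicCompletion (maximalRealSubfield L)) ((cmQuadraticGenerator L : maximalRealSubfield L) : maximalRealSubfield L) *
        (algebraMap (maximalRealSubfield L) (v.adicCompletion (maximalRealSubfield L)) t) ^ 2 := by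
    have h1 : (imagUnitSq L : maximalRealSubfield L) = (cmQuadraticGenerator L : maximalRealSubfield L) * t ^ 2 :=
      (algebraMap (maximalRealSubfield L) L).injective (by rw [map_mul, map_pow]; exact ht)
    rw [← map_pow, ← map_mul, ← h1]
    rfl
  have htv : algebraMap (maximalRealSubfield L) (v.adicCompletion (maximalRealSubfield L)) t ≠ 0 := (_root_.map_ne_zero _).2 ht0
  rw [MonoidHom.inv_apply, Units.val_inv_eq_inv_val, hval, ht', hilbertSymbol_mul_sq_left _ _ htv, hilbertSymbol_comm]
  rcases hilbertSymbol_eq_one_or_eq_neg_one (algebraMap (maximalRealSubfield L) (v.adicCompletion (maximalRealSubfield L)) ((cmQuadraticGenerator L : maximalRealSubfield L) : maximalRealSubfield L))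
      (a : v.adicCompletion (maximalRealSubfield L)) with h | h
  · rw [h]; norm_num
  · rw [h]; norm_num

/-- **THE TWO LOCAL COMPONENTS ABOVE A SPLIT PLACE OF A SPLITTING CHARACTER ARE TIED** (hypothesis `IsSplitPair` of
the GR-1 skeleton, for `χv w := χ_w⁻¹`): if `χ|_{𝕀_{L⁺}} = ε_{L/L⁺}` and `c • w ≠ w`, then for every `x ∈ L_{w̄}ˣ`
(`w̄ = c⁻¹ • w`): `χ_{w̄}⁻¹(x) = (χ_w⁻¹(c_* x))⁻¹`, `c_* : L_{w̄} ≃ L_w` the transport of structure along `c`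
(`ε_v = 1` at a split place). [cite: HarrisKudlaSweet1996, §1 (1.5), (1.15)] -/
theorem localComponent_galInv_inv_eq (χ : HeckeCharacter L) (hχ : IsSplittingChar L 1 χ)
    (w : PlacesOver L v) (hw : cc • w.1 ≠ w.1)
    (x : ((PlacesOver.galInv (cc) w).1.adicCompletion L)ˣ) :
    ((χ.localComponent (PlacesOver.galInv (cc) w).1)⁻¹ :
        ((PlacesOver.galInv (cc) w).1.adicCompletion L)ˣ →* ℂˣ) x =
      (((χ.localComponent w.1)⁻¹ : (w.1.adicCompletion L)ˣ →* ℂˣ)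
        (Units.map (galAdicCompletionMap (cc)
          (smul_inv_smul (cc) w.1)).toMonoidHom x))⁻¹ := by
  -- `x = ι_{w̄} a`: `ι_{w̄}` is onto at the split place
  have hwb' : cc • (PlacesOver.galInv cc w).1 ≠ (PlacesOver.galInv cc w).1 := by
    change cc • cc⁻¹ • w.1 ≠ cc⁻¹ • w.1
    rw [smul_inv_smul]
    intro h
    exact hw (by conv_lhs => rw [h]; exact smul_inv_smul cc w.1)
  obtain ⟨he, hf⟩ := ramificationIdx_eq_one_and_inertiaDeg_eq_one_of_smul_ne (F := maximalRealSubfield L) cc hwb'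
  haveI := PlacesOver.liesOver (PlacesOver.galInv cc w)
  have hsurj := (bijective_adicCompletionOfLiesOver_of_degree_one (maximalRealSubfield L) L v (PlacesOver.galInv cc w).1 he hf).2
  obtain ⟨a₀, ha₀⟩ := hsurj (x : (PlacesOver.galInv cc w).1.adicCompletion L)
  have ha₀u : IsUnit a₀ := by
    rw [isUnit_iff_ne_zero]
    rintro rfl
    exact x.ne_zero (by rw [← ha₀, map_zero])
  have hax : Units.map (toPlace v (PlacesOver.galInv cc w) : v.adicCompletion (maximalRealSubfield L) →* (PlacesOver.galInv cc w).1.adicCompletion L) ha₀u.unit = x :=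
    Units.ext (by rw [Units.coe_map, IsUnit.unit_spec]; exact ha₀)
  -- `χ(⟨a⟩_v ⊗ 1) = ε_v(a) = (a, θ)_v = 1`
  have key := hχ (localUnits v ha₀u.unit)
  rw [pow_one, ideleBaseChange_localUnits_of_smul_ne L v w hw, _root_.map_mul, quadraticHeckeCharCM_def] at key
  have hε : ((quadraticHeckeChar (maximalRealSubfield L) (cmQuadraticGenerator L) (not_isSquare_cmQuadraticGenerator L)
      (localUnits v ha₀u.unit) : ℂˣ) : ℂ) = 1 := by
    have hθ0 : ((cmQuadraticGenerator L : 𝓞 (maximalRealSubfield L)) : maximalRealSubfield L) ≠ 0 := by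
      exact_mod_cast RingOfIntegers.ne_zero_of_not_isSquare (maximalRealSubfield L) (not_isSquare_cmQuadraticGenerator L)
    rw [quadraticHeckeChar_localUnits (not_isSquare_cmQuadraticGenerator L) v, hilbertSymbol_comm,
      hilbertSymbol_eq_one_of_isSquare (isSquare_cmQuadraticGenerator_of_smul_ne L v w hw)
        ((_root_.map_ne_zero _).2 hθ0)]
    norm_num
  have key' : χ (localUnits w.1 (Units.map (toPlace v w : v.adicCompletion (maximalRealSubfield L) →* w.1.adicCompletion L) ha₀u.unit)) *
      χ (localUnits (PlacesOver.galInv cc w).1 (Units.map (toPlace v (PlacesOver.galInv cc w) : v.adicCompletion (maximalRealSubfield L) →* (PlacesOver.galInv cc w).1.adicCompletion L) ha₀u.unit)) = 1 := by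
    rw [key]
    exact Units.ext (by rw [hε, Units.val_one])
  -- `c_* (ι_{w̄} a) = ι_w a`
  have hcx : Units.map (galAdicCompletionMap cc (smul_inv_smul cc w.1)).toMonoidHom x =
      Units.map (toPlace v w : v.adicCompletion (maximalRealSubfield L) →* w.1.adicCompletion L) ha₀u.unit := by
    rw [← hax, ← MonoidHom.comp_apply, ← Units.map_comp]
    exact Units.ext (galAdicCompletionMap_toPlace cc (PlacesOver.galInv cc w) w (smul_inv_smul cc w.1) _)
  rw [hcx, MonoidHom.inv_apply, MonoidHom.inv_apply, inv_inv, HeckeCharacter.localComponent_apply,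
    HeckeCharacter.localComponent_apply, ← hax]
  exact inv_eq_of_mul_eq_one_left key'

end CM

end Literature.NumberTheory.GelbartRogawski1991.UnitaryDualPair.LocalSplitting

end
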